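import Summits.AtomisticToContinuum.Crystallization.Theorems.HullExactificationCascadeRobustBarlowTemplateTransportSteps1
import Summits.AtomisticToContinuum.Crystallization.Theorems.HullExactificationCascadeRobustBarlowTemplateTransportSteps2
import Summits.AtomisticToContinuum.Crystallization.Theorems.HullExactificationCascadeRobustBarlowTemplateTransportVinv
import Summits.AtomisticToContinuum.Crystallization.Theorems.HullExactificationCascadeRobustBarlowTemplateTransportAttach1
import Summits.AtomisticToContinuum.Crystallization.Theorems.HullExactificationCascadeRobustBarlowTemplateTransportAttach2
import Summits.AtomisticToContinuum.Crystallization.Theorems.PalmUnimodularRigidityShellsToBarlowChartTransportComm2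

/-!
# Line `registered` (crux `RobustBarlowTemplate`, stmt-AtomisticToContinuum-12088): commutation of `V⁻¹` with `I` and `J` (part 1/3)

Helper lemmas for `develop_transport` (the geometric half of the development): frames
`⟨x, t₁, t₂, U⟩` read in the scale-relative integer charts `IsZChart` of an everywhere-good
configuration, their transports and the coherence of the resulting development `frameAt`.  The
only metric inputs are the chart transfer lemma `develop_transfer` and `bond_nb_iff`; everything
else is label combinatorics in `ℤ³` (pattern facts `TransportPatterns*` of the sibling crux 9227,
imported verbatim).  All `[folklore]` (HalesDSP2012 §1.3 for the two kissing patterns).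

PORT of `PalmUnimodularRigidityShellsToBarlowChartTransportVComm1.lean` of the closed sibling
crux `ShellsToBarlowChart` (stmt-9227) to the SCALE-RELATIVE shell relation `y ∈ shell S x` of
this crux (in place of the bond window `0 < dist x y ∧ dist x y ≤ 28/25`) and to the
five-argument charts `IsZChart S x P A nbr`; the port rules (conjunct paths,
`bond a b ↦ b ∈ shell S a`, the threaded symmetry hypothesis
`hsy : ∀ x ∈ S, ∀ y ∈ shell S x, x ∈ shell S y` replacing `bond_symm`, `zchart_transfer` /
`zchart_sqNormInt_eq` replacing `sqNormInt_transfer` / `IsZChart.sqNormInt_eq`, the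
`open … hiding …` line) are listed under "Port notes" in `…RobustBarlowTemplateTransportSteps1.lean`
(and its extensions in `…TransportSteps6.lean`, `…TransportAttach1.lean`).

## Port notes (this part: `TransportVComm1`)
* the signatures of `attach_lower_J_pos`, `attach_lower_J_neg`, `VinvStep_Istep_pt`,
  `VinvStep_Jstep_pt` are parallel to the source with `hsy` inserted right after `hch` (their
  proofs call `attach_lower_I_pos/neg`, `Istep_spec`, `VinvStep_spec`, `transfer_nb_nb`,
  `transfer_nb_centre`, which need symmetry); the bond conjunct of the conclusions of
  `VinvStep_Istep_pt` / `VinvStep_Jstep_pt` became the shell membership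
  `(VinvStep Pc nb (Istep Pc nb ⟨x, t₁, t₂, U⟩)).pt ∈ shell S (VinvStep Pc nb ⟨x, t₁, t₂, U⟩).pt`
  (resp. `Jstep`); inside the proofs `bond_symm hbd` / `bond_symm hbdy` became `hsy _ hx _ hbd` /
  `hsy _ hdS _ hbdy`; otherwise the proofs are the source proofs verbatim up to the rules (no
  metric constant occurs in this part);
* the two CHART-AGNOSTIC helpers used from the 9227 commutation files, `hregI_of_valid` (9227
  `Comm1`) and `swap_hyps` (9227 `Comm2`: pure `OpsDefs` statements, no chart hypothesis), are
  NOT re-proved (the gate forbids restating landed declarations): the 9227 module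
  `…ShellsToBarlowChartTransportComm2` is imported for them.  Nothing chart-dependent of the
  source's imports `Comm1`, `Comm2` is used by this part, so the ported `…TransportComm1/2` of
  this crux are NOT imported (imports: our parts 1, 2, `Vinv`, `Attach1`, `Attach2` and the 9227
  `Comm2`); since that import makes the 9227 `Attach2`, `Comm1`, `Comm2` visible, the
  `open … hiding …` line of our `…TransportAttach1` is EXTENDED by the chart-dependent 9227 names
  redeclared (or to be redeclared) in our `Attach2`, `Comm1`, `Comm2` (`attach_lower_I_pos`,
  `attach_lower_I_neg`, `attach_J_even`, `attach_J_odd`, `Vstep_Istep_pt`, `Vstep_Istep_back`,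
  `Vstep_Istep_side`, `Vstep_Jstep_pt`) — inside this namespace our declarations take precedence
  anyway; copy this longer line into later parts;
* the anchor at the end (explicit-`∀` form of `VinvStep_Istep_pt`, registered sub-goal) is new.
-/

noncomputable section

namespace Summit.AtomisticToContinuum.Crystallization.Theorems.HullExactificationCascadeRobustBarlowTemplate

open Literature.Geometry.DiscreteGeometry Literature.MathematicalPhysics.StatisticalMechanics
open Summit.AtomisticToContinuum.Crystallization.Theorems.PalmUnimodularRigidityShellsToBarlowChart hiding
  IsZChart TransportSystem scales_tied sqNormInt_transfer bond_symm nb_mem zlab_spec zlab_nb bond_nb_iff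
  pattern_cases transfer_nb_nb transfer_nb_centre transfer_nb_target sqNormInt_zlab_centre hcp_of_mirror_pair
  Istep_spec Jstep_spec IinvStep_spec JinvStep_spec capWithAny_of_mem_cap IinvStep_Istep Istep_IinvStep
  JinvStep_Jstep Jstep_JinvStep polar_at_apex onesided_at_apex nb_inj Istep_lower Jstep_lower
  IinvStep_lower JinvStep_lower Vstep_spec polar_at_lower_apex onesided_at_lower_apex VinvStep_spec
  attach_I_even attach_I_odd attach_lower_I_pos attach_lower_I_neg attach_J_even attach_J_odd
  Vstep_Istep_pt Vstep_Istep_back Vstep_Istep_side Vstep_Jstep_pt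

variable {S : Set (EuclideanSpace ℝ (Fin 3))} {Pc : (EuclideanSpace ℝ (Fin 3)) → Finset (Fin 3 → ℤ)}
  {Ac : (EuclideanSpace ℝ (Fin 3)) → ((EuclideanSpace ℝ (Fin 3)) →ₗᵢ[ℝ] (EuclideanSpace ℝ (Fin 3)))} {nb : (EuclideanSpace ℝ (Fin 3)) → (Fin 3 → ℤ) → (EuclideanSpace ℝ (Fin 3))}

/-- **Lower attachment across J, letter below `+1`** (from the I-version by the swap symmetry).
[folklore] -/
theorem attach_lower_J_pos (hch : ∀ z ∈ S, IsZChart S z (Pc z) (Ac z) (nb z))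
    (hsy : ∀ x ∈ S, ∀ y ∈ shell S x, x ∈ shell S y) {x : (EuclideanSpace ℝ (Fin 3))} (hx : x ∈ S) {t₁ t₂ : Fin 3 → ℤ} {U : Finset (Fin 3 → ℤ)} (hU : IsFrame (Pc x) t₁ t₂ U) (hlp : lowerParity t₁ t₂ (lowerCap (Pc x) t₁ t₂ U) = 1) (hreg : Pc (nb x t₂) = fcc3Int ∨ Pc x = hcpInt ∨ (-zlab Pc nb (nb x t₂) x ∈ Pc (nb x t₂) ∧ -zlab Pc nb (nb x t₂) (nb x t₁) ∈ Pc (nb x t₂))) : lowerParity (Jstep Pc nb ⟨x, t₁, t₂, U⟩).t₁ (Jstep Pc nb ⟨x, t₁, t₂, U⟩).t₂ (lowerCap (Pc (nb x t₂)) (Jstep Pc nb ⟨x, t₁, t₂, U⟩).t₁ (Jstep Pc nb ⟨x, t₁, t₂, U⟩).t₂ (Jstep Pc nb ⟨x, t₁, t₂, U⟩).U) = 1 ∧ nb (nb x t₂) (apexOf (Jstep Pc nb ⟨x, t₁, t₂, U⟩).t₁ (Jstep Pc nb ⟨x, t₁, t₂, U⟩).t₂ (lowerCap (Pc (nb x t₂))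 (Jstep Pc nb ⟨x, t₁, t₂, U⟩).t₁ (Jstep Pc nb ⟨x, t₁, t₂, U⟩).t₂ (Jstep Pc nb ⟨x, t₁, t₂, U⟩).U)) = nb x (apexOf t₁ t₂ (lowerCap (Pc x) t₁ t₂ U) + t₂) ∧ zlab Pc nb (nb x t₂) (nb x (apexOf t₁ t₂ (lowerCap (Pc x) t₁ t₂ U) + t₂)) = apexOf (Jstep Pc nb ⟨x, t₁, t₂, U⟩).t₁ (Jstep Pc nb ⟨x, t₁, t₂, U⟩).t₂ (lowerCap (Pc (nb x t₂)) (Jstep Pc nb ⟨x, t₁, t₂, U⟩).t₁ (Jstep Pc nb ⟨x, t₁, t₂, U⟩).t₂ (Jstep Pc nb ⟨x, t₁, t₂, U⟩).U) := by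
  have hPx := pattern_cases hch hx
  have hU' : IsFrame (Pc x) t₂ t₁ U := isFrame_swap hU
  have hlp' : lowerParity t₂ t₁ (lowerCap (Pc x) t₂ t₁ U) = 1 := by
    rw [lowerCap_comm, lowerParity_swap]; exact hlp
  obtain ⟨h1, h2, h3⟩ := attach_lower_I_pos hch hsy hx hU' hlp' hreg
  obtain ⟨-, -, -, -, -, -, -, -, -, -, -, hframe', -⟩ := Istep_spec hch hsy hx hU' hreg
  have hPy := pattern_cases hch (nb_mem hch hx (hU.2.1 (mem_hexLabels_iff.2 (Or.inr (Or.inl rfl))))).1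
  have hLx : lowerCap (Pc x) t₂ t₁ U = lowerCap (Pc x) t₁ t₂ U := lowerCap_comm _ _ _ _
  have hax : apexOf t₂ t₁ (lowerCap (Pc x) t₁ t₂ U) = apexOf t₁ t₂ (lowerCap (Pc x) t₁ t₂ U) :=
    apexOf_swap hPx (isFrame_lowerCap hPx hU)
  rw [hLx, hax] at h2 h3
  rw [Jstep_swap]
  have hLy : lowerCap (Pc (nb x t₂)) (Istep Pc nb ⟨x, t₂, t₁, U⟩).t₂ (Istep Pc nb ⟨x, t₂, t₁, U⟩).t₁
      (Istep Pc nb ⟨x, t₂, t₁, U⟩).U = lowerCap (Pc (nb x t₂)) (Istep Pc nb ⟨x, t₂, t₁, U⟩).t₁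
      (Istep Pc nb ⟨x, t₂, t₁, U⟩).t₂ (Istep Pc nb ⟨x, t₂, t₁, U⟩).U := lowerCap_comm _ _ _ _
  have hay : apexOf (Istep Pc nb ⟨x, t₂, t₁, U⟩).t₂ (Istep Pc nb ⟨x, t₂, t₁, U⟩).t₁
      (lowerCap (Pc (nb x t₂)) (Istep Pc nb ⟨x, t₂, t₁, U⟩).t₁ (Istep Pc nb ⟨x, t₂, t₁, U⟩).t₂
        (Istep Pc nb ⟨x, t₂, t₁, U⟩).U) = apexOf (Istep Pc nb ⟨x, t₂, t₁, U⟩).t₁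
      (Istep Pc nb ⟨x, t₂, t₁, U⟩).t₂ (lowerCap (Pc (nb x t₂)) (Istep Pc nb ⟨x, t₂, t₁, U⟩).t₁
        (Istep Pc nb ⟨x, t₂, t₁, U⟩).t₂ (Istep Pc nb ⟨x, t₂, t₁, U⟩).U) :=
    apexOf_swap hPy (isFrame_lowerCap hPy hframe')
  show lowerParity _ _ (lowerCap (Pc (nb x t₂)) (Istep Pc nb ⟨x, t₂, t₁, U⟩).t₂
      (Istep Pc nb ⟨x, t₂, t₁, U⟩).t₁ (Istep Pc nb ⟨x, t₂, t₁, U⟩).U) = 1 ∧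
    nb (nb x t₂) (apexOf _ _ (lowerCap (Pc (nb x t₂)) (Istep Pc nb ⟨x, t₂, t₁, U⟩).t₂
      (Istep Pc nb ⟨x, t₂, t₁, U⟩).t₁ (Istep Pc nb ⟨x, t₂, t₁, U⟩).U)) = _ ∧
    _ = apexOf _ _ (lowerCap (Pc (nb x t₂)) (Istep Pc nb ⟨x, t₂, t₁, U⟩).t₂
      (Istep Pc nb ⟨x, t₂, t₁, U⟩).t₁ (Istep Pc nb ⟨x, t₂, t₁, U⟩).U)
  rw [hLy, lowerParity_swap, hay]
  exact ⟨h1, h2, h3⟩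

/-- **Lower attachment across J, letter below `−1`** (from the I-version by the swap symmetry).
[folklore] -/
theorem attach_lower_J_neg (hch : ∀ z ∈ S, IsZChart S z (Pc z) (Ac z) (nb z))
    (hsy : ∀ x ∈ S, ∀ y ∈ shell S x, x ∈ shell S y) {x : (EuclideanSpace ℝ (Fin 3))}
    (hx : x ∈ S) {t₁ t₂ : Fin 3 → ℤ} {U : Finset (Fin 3 → ℤ)} (hU : IsFrame (Pc x) t₁ t₂ U)
    (hlp : lowerParity t₁ t₂ (lowerCap (Pc x) t₁ t₂ U) = -1)
    (hreg : Pc (nb x t₂) = fcc3Int ∨ Pc x = hcpInt ∨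
      (-zlab Pc nb (nb x t₂) x ∈ Pc (nb x t₂) ∧ -zlab Pc nb (nb x t₂) (nb x t₁) ∈ Pc (nb x t₂))) :
    lowerParity (Jstep Pc nb ⟨x, t₁, t₂, U⟩).t₁ (Jstep Pc nb ⟨x, t₁, t₂, U⟩).t₂
        (lowerCap (Pc (nb x t₂)) (Jstep Pc nb ⟨x, t₁, t₂, U⟩).t₁ (Jstep Pc nb ⟨x, t₁, t₂, U⟩).t₂
          (Jstep Pc nb ⟨x, t₁, t₂, U⟩).U) = -1 ∧
    nb (nb x t₂) (apexOf (Jstep Pc nb ⟨x, t₁, t₂, U⟩).t₁ (Jstep Pc nb ⟨x, t₁, t₂, U⟩).t₂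
        (lowerCap (Pc (nb x t₂)) (Jstep Pc nb ⟨x, t₁, t₂, U⟩).t₁ (Jstep Pc nb ⟨x, t₁, t₂, U⟩).t₂
          (Jstep Pc nb ⟨x, t₁, t₂, U⟩).U) - (Jstep Pc nb ⟨x, t₁, t₂, U⟩).t₂) =
      nb x (apexOf t₁ t₂ (lowerCap (Pc x) t₁ t₂ U)) ∧
    zlab Pc nb (nb x t₂) (nb x (apexOf t₁ t₂ (lowerCap (Pc x) t₁ t₂ U))) =
      apexOf (Jstep Pc nb ⟨x, t₁, t₂, U⟩).t₁ (Jstep Pc nb ⟨x, t₁, t₂, U⟩).t₂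
        (lowerCap (Pc (nb x t₂)) (Jstep Pc nb ⟨x, t₁, t₂, U⟩).t₁ (Jstep Pc nb ⟨x, t₁, t₂, U⟩).t₂
          (Jstep Pc nb ⟨x, t₁, t₂, U⟩).U) - (Jstep Pc nb ⟨x, t₁, t₂, U⟩).t₂ := by
  have hPx := pattern_cases hch hx
  have hU' : IsFrame (Pc x) t₂ t₁ U := isFrame_swap hU
  have hlp' : lowerParity t₂ t₁ (lowerCap (Pc x) t₂ t₁ U) = -1 := by
    rw [lowerCap_comm, lowerParity_swap]; exact hlp
  obtain ⟨h1, h2, h3⟩ := attach_lower_I_neg hch hsy hx hU' hlp' hreg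
  obtain ⟨-, -, -, -, -, -, -, -, -, -, -, hframe', -⟩ := Istep_spec hch hsy hx hU' hreg
  have hPy := pattern_cases hch (nb_mem hch hx (hU.2.1 (mem_hexLabels_iff.2 (Or.inr (Or.inl rfl))))).1
  have hLx : lowerCap (Pc x) t₂ t₁ U = lowerCap (Pc x) t₁ t₂ U := lowerCap_comm _ _ _ _
  have hax : apexOf t₂ t₁ (lowerCap (Pc x) t₁ t₂ U) = apexOf t₁ t₂ (lowerCap (Pc x) t₁ t₂ U) :=
    apexOf_swap hPx (isFrame_lowerCap hPx hU)
  rw [hLx, hax] at h2 h3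
  rw [Jstep_swap]
  have hLy : lowerCap (Pc (nb x t₂)) (Istep Pc nb ⟨x, t₂, t₁, U⟩).t₂ (Istep Pc nb ⟨x, t₂, t₁, U⟩).t₁
      (Istep Pc nb ⟨x, t₂, t₁, U⟩).U = lowerCap (Pc (nb x t₂)) (Istep Pc nb ⟨x, t₂, t₁, U⟩).t₁
      (Istep Pc nb ⟨x, t₂, t₁, U⟩).t₂ (Istep Pc nb ⟨x, t₂, t₁, U⟩).U := lowerCap_comm _ _ _ _
  have hay : apexOf (Istep Pc nb ⟨x, t₂, t₁, U⟩).t₂ (Istep Pc nb ⟨x, t₂, t₁, U⟩).t₁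
      (lowerCap (Pc (nb x t₂)) (Istep Pc nb ⟨x, t₂, t₁, U⟩).t₁ (Istep Pc nb ⟨x, t₂, t₁, U⟩).t₂
        (Istep Pc nb ⟨x, t₂, t₁, U⟩).U) = apexOf (Istep Pc nb ⟨x, t₂, t₁, U⟩).t₁
      (Istep Pc nb ⟨x, t₂, t₁, U⟩).t₂ (lowerCap (Pc (nb x t₂)) (Istep Pc nb ⟨x, t₂, t₁, U⟩).t₁
        (Istep Pc nb ⟨x, t₂, t₁, U⟩).t₂ (Istep Pc nb ⟨x, t₂, t₁, U⟩).U) :=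
    apexOf_swap hPy (isFrame_lowerCap hPy hframe')
  show lowerParity _ _ (lowerCap (Pc (nb x t₂)) (Istep Pc nb ⟨x, t₂, t₁, U⟩).t₂
      (Istep Pc nb ⟨x, t₂, t₁, U⟩).t₁ (Istep Pc nb ⟨x, t₂, t₁, U⟩).U) = -1 ∧
    nb (nb x t₂) (apexOf _ _ (lowerCap (Pc (nb x t₂)) (Istep Pc nb ⟨x, t₂, t₁, U⟩).t₂
      (Istep Pc nb ⟨x, t₂, t₁, U⟩).t₁ (Istep Pc nb ⟨x, t₂, t₁, U⟩).U) - _) = _ ∧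
    _ = apexOf _ _ (lowerCap (Pc (nb x t₂)) (Istep Pc nb ⟨x, t₂, t₁, U⟩).t₂
      (Istep Pc nb ⟨x, t₂, t₁, U⟩).t₁ (Istep Pc nb ⟨x, t₂, t₁, U⟩).U) - _
  rw [hLy, lowerParity_swap, hay]
  exact ⟨h1, h2, h3⟩

/-- **`V⁻¹ ∘ I`, the point.**  For a valid frame `g` whose four in-layer transports are valid,
the lower apex site below `Ix` is the `t₁`-neighbour of the frame `V⁻¹ g` at the lower apex site
`d` below `x`, and its label at `d` is `(V⁻¹ g).t₁`: in the model both are `(k−1, i+1, j)`.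
[folklore] -/
theorem VinvStep_Istep_pt (hch : ∀ z ∈ S, IsZChart S z (Pc z) (Ac z) (nb z))
    (hsy : ∀ x ∈ S, ∀ y ∈ shell S x, x ∈ shell S y) {x : (EuclideanSpace ℝ (Fin 3))}
    (hx : x ∈ S) {t₁ t₂ : Fin 3 → ℤ} {U : Finset (Fin 3 → ℤ)} (hU : IsFrame (Pc x) t₁ t₂ U)
    (hI : IsFrame (Pc (nb x t₁)) (Istep Pc nb ⟨x, t₁, t₂, U⟩).t₁ (Istep Pc nb ⟨x, t₁, t₂, U⟩).t₂
      (Istep Pc nb ⟨x, t₁, t₂, U⟩).U)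
    (hJ : IsFrame (Pc (nb x t₂)) (Jstep Pc nb ⟨x, t₁, t₂, U⟩).t₁ (Jstep Pc nb ⟨x, t₁, t₂, U⟩).t₂
      (Jstep Pc nb ⟨x, t₁, t₂, U⟩).U)
    (hIi : IsFrame (Pc (nb x (-t₁))) (IinvStep Pc nb ⟨x, t₁, t₂, U⟩).t₁
      (IinvStep Pc nb ⟨x, t₁, t₂, U⟩).t₂ (IinvStep Pc nb ⟨x, t₁, t₂, U⟩).U)
    (hJi : IsFrame (Pc (nb x (-t₂))) (JinvStep Pc nb ⟨x, t₁, t₂, U⟩).t₁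
      (JinvStep Pc nb ⟨x, t₁, t₂, U⟩).t₂ (JinvStep Pc nb ⟨x, t₁, t₂, U⟩).U) :
    (VinvStep Pc nb (Istep Pc nb ⟨x, t₁, t₂, U⟩)).pt =
        nb (VinvStep Pc nb ⟨x, t₁, t₂, U⟩).pt (VinvStep Pc nb ⟨x, t₁, t₂, U⟩).t₁ ∧
      (VinvStep Pc nb (Istep Pc nb ⟨x, t₁, t₂, U⟩)).pt ∈ shell S (VinvStep Pc nb ⟨x, t₁, t₂, U⟩).pt ∧
      zlab Pc nb (VinvStep Pc nb ⟨x, t₁, t₂, U⟩).pt (VinvStep Pc nb (Istep Pc nb ⟨x, t₁, t₂, U⟩)).pt =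
        (VinvStep Pc nb ⟨x, t₁, t₂, U⟩).t₁ := by
  have hregI := hregI_of_valid (Pc := Pc) (nb := nb) hI
  obtain ⟨hyS, hbxy, hwP, hwx, -, -, -, -, -, -, -, hframe, hparI, -⟩ := Istep_spec hch hsy hx hU hregI
  obtain ⟨hd'L, hdS, hbd, hξP, hξx, hframeVi, -, hbr⟩ := VinvStep_spec hch hsy hx hU hI hJ hIi hJi
  have hPx := pattern_cases hch hx
  have hPy := pattern_cases hch hyS
  have hPd := pattern_cases hch hdS
  obtain ⟨h12, hhex, hUP, -, -⟩ := id hU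
  have ht₁ : t₁ ∈ Pc x := hhex (mem_hexLabels_iff.2 (Or.inl rfl))
  have ht₂ : t₂ ∈ Pc x := hhex (mem_hexLabels_iff.2 (Or.inr (Or.inl rfl)))
  have hnt₁ : -t₁ ∈ Pc x := hhex (mem_hexLabels_iff.2 (Or.inr (Or.inr (Or.inr (Or.inl rfl)))))
  -- canonical names
  set d' := apexOf t₁ t₂ (lowerCap (Pc x) t₁ t₂ U) with hd'_def
  have hd'P : d' ∈ Pc x := (mem_lowerCap_iff.1 hd'L).1
  have hd'hex : d' ∉ hexLabels t₁ t₂ := (mem_lowerCap_iff.1 hd'L).2.1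
  have hpt : (VinvStep Pc nb (Istep Pc nb ⟨x, t₁, t₂, U⟩)).pt =
      nb (nb x t₁) (apexOf (Istep Pc nb ⟨x, t₁, t₂, U⟩).t₁ (Istep Pc nb ⟨x, t₁, t₂, U⟩).t₂
        (lowerCap (Pc (nb x t₁)) (Istep Pc nb ⟨x, t₁, t₂, U⟩).t₁ (Istep Pc nb ⟨x, t₁, t₂, U⟩).t₂
          (Istep Pc nb ⟨x, t₁, t₂, U⟩).U)) := rfl
  have hVpt : (VinvStep Pc nb ⟨x, t₁, t₂, U⟩).pt = nb x d' := rfl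
  rw [hpt, hVpt] at *
  set d := nb x d' with hd_def
  set τ₁ := (VinvStep Pc nb ⟨x, t₁, t₂, U⟩).t₁ with hτ₁_def
  have hτ₁P : τ₁ ∈ Pc d := hframeVi.2.1 (mem_hexLabels_iff.2 (Or.inl rfl))
  have Dτ₁ : sqNormInt τ₁ = 18 := zchart_sqNormInt_eq (hch d hdS) hτ₁P
  set ξ := zlab Pc nb d x with hξ_def
  rcases hbr with ⟨hlp, hUd, hnI, -, hLeq⟩ | ⟨hlp, hUd, hnI, -, hLeq⟩
  · /- letter below `+1`: `d₁ = nb x (d' + t₁)` is read in the chart of `x` -/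
    obtain ⟨-, hatt, -⟩ := attach_lower_I_pos hch hsy hx hU hlp hregI
    rw [hatt]
    obtain ⟨-, -, -, hd1, hd2, -⟩ := pos_form_of_lowerParity hPx hU hlp
    have hdx := dist_oddCap (Pc x) hPx t₁ ht₁ t₂ ht₂ d' hd'P h12 hhex hd'hex hd1 hd2
    -- `η = ξ − τ₁` labels `I⁻¹x`
    have hηP : ξ - τ₁ ∈ Pc d := hframeVi.2.2.1 (by rw [hUd]; simp)
    have hη : zlab Pc nb d (nb x (-t₁)) = ξ - τ₁ := by rw [← hnI]; exact zlab_nb hch hdS hηP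
    have hbdm : nb x (-t₁) ∈ shell S d :=
      (bond_nb_iff hch hx hd'P hnt₁).2 (by rw [sqNormInt_sub_comm]; exact hdx.1)
    have hbdd₁ : nb x (d' + t₁) ∈ shell S d :=
      (bond_nb_iff hch hx hd'P hd1).2 hdx.2.2.2.2.2.2.2.2.2.2.1
    have hd₁S : nb x (d' + t₁) ∈ S := (nb_mem hch hx hd1).1
    have hθ := zlab_spec hch hdS hd₁S hbdd₁
    have Dθξ : sqNormInt (zlab Pc nb d (nb x (d' + t₁)) - ξ) = 18 := by
      rw [hξ_def, transfer_nb_centre hch hsy hx hdS hbd hd1 hbdd₁]; exact zchart_sqNormInt_eq (hch x hx) hd1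
    have Dθη : sqNormInt (zlab Pc nb d (nb x (d' + t₁)) - zlab Pc nb d (nb x (-t₁))) = 54 := by
      rw [transfer_nb_nb hch hsy hx hdS hbd hd1 hnt₁ hbdd₁ hbdm]
      exact (dist_oddCap_ca (Pc x) hPx t₁ ht₁ t₂ ht₂ d' hd'P h12 hhex hd'hex hd1 hd2).2.2.2.1
    have hθeq : zlab Pc nb d (nb x (d' + t₁)) = τ₁ := by
      have h := label_third_vertex (Pc d) hPd (ξ - τ₁) hηP ξ hξP _ hθ.1
        (by rw [show ξ - τ₁ - ξ = -τ₁ by abel, sqNormInt_neg]; exact Dτ₁)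
        Dθξ (by rw [← hη]; exact Dθη) (by rw [show ξ - (ξ - τ₁) = τ₁ by abel]; exact hτ₁P)
      rw [h]; abel
    refine ⟨?_, hbdd₁, hθeq⟩
    rw [← hθeq]; exact hθ.2.symm
  · /- letter below `−1`: `d = nb y (dL' − a')`, `d₁ = nb y dL'` are read in the chart of `y` -/
    obtain ⟨hlp', hatt, hlab⟩ := attach_lower_I_neg hch hsy hx hU hlp hregI
    set a' := (Istep Pc nb ⟨x, t₁, t₂, U⟩).t₁ with ha'
    set b' := (Istep Pc nb ⟨x, t₁, t₂, U⟩).t₂ with hb'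
    set U' := (Istep Pc nb ⟨x, t₁, t₂, U⟩).U with hU'
    obtain ⟨h12', hhex', hUP', -, -⟩ := id hframe
    have ha'P : a' ∈ Pc (nb x t₁) := hhex' (mem_hexLabels_iff.2 (Or.inl rfl))
    have hb'P : b' ∈ Pc (nb x t₁) := hhex' (mem_hexLabels_iff.2 (Or.inr (Or.inl rfl)))
    obtain ⟨hdL'L, hdL'P, hdL'hex, hd1', hd2', hL'eq⟩ := neg_form_of_lowerParity hPy hframe hlp'
    set dL' := apexOf a' b' (lowerCap (Pc (nb x t₁)) a' b' U') with hdL'_def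
    have hdy : nb (nb x t₁) (dL' - a') = d := hatt
    -- `η₊ = ξ + τ₁` labels `Ix = y`
    have hηP : ξ + τ₁ ∈ Pc d := hframeVi.2.2.1 (by rw [hUd]; simp)
    have hη : zlab Pc nb d (nb x t₁) = ξ + τ₁ := by rw [← hnI]; exact zlab_nb hch hdS hηP
    have hbdy : nb x t₁ ∈ shell S d := by
      rw [← hnI]; exact (nb_mem hch hdS hηP).2
    have hbdd₁ : nb (nb x t₁) dL' ∈ shell S d := by
      have := (bond_nb_iff hch hyS hd1' hdL'P).2 (by
        rw [show dL' - a' - dL' = -a' by abel, sqNormInt_neg]; exact zchart_sqNormInt_eq (hch _ hyS) ha'P)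
      rwa [hdy] at this
    have hd₁S : nb (nb x t₁) dL' ∈ S := (nb_mem hch hyS hdL'P).1
    have hθ := zlab_spec hch hdS hd₁S hbdd₁
    have Dθη : sqNormInt (zlab Pc nb d (nb (nb x t₁) dL') - zlab Pc nb d (nb x t₁)) = 18 := by
      rw [transfer_nb_centre hch hsy hyS hdS (hsy _ hdS _ hbdy) hdL'P hbdd₁]
      exact zchart_sqNormInt_eq (hch _ hyS) hdL'P
    have Dθξ : sqNormInt (zlab Pc nb d (nb (nb x t₁) dL') - ξ) = 54 := by
      have hbdx : nb (nb x t₁) (zlab Pc nb (nb x t₁) x) ∈ shell S d := by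
        rw [hwx]; exact hsy _ hx _ hbd
      have htr := transfer_nb_nb hch hsy hyS hdS (hsy _ hdS _ hbdy) hdL'P hwP hbdd₁ hbdx
      rw [hwx] at htr
      rw [hξ_def, htr]
      have h54 := (dist_evenCap_c (Pc (nb x t₁)) hPy a' ha'P b' hb'P dL' hdL'P h12' hhex' hdL'hex
        hd1' hd2').2.2.2.1
      have e : -a' = zlab Pc nb (nb x t₁) x := by show -(-zlab Pc nb (nb x t₁) x) = _; rw [neg_neg]
      rwa [e] at h54
    have hθeq : zlab Pc nb d (nb (nb x t₁) dL') = τ₁ := by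
      have h := label_third_vertex (Pc d) hPd ξ hξP (ξ + τ₁) hηP _ hθ.1
        (by rw [show ξ - (ξ + τ₁) = -τ₁ by abel, sqNormInt_neg]; exact Dτ₁)
        (by rw [← hη]; exact Dθη) Dθξ (by rw [show ξ + τ₁ - ξ = τ₁ by abel]; exact hτ₁P)
      rw [h]; abel
    refine ⟨?_, hbdd₁, hθeq⟩
    rw [← hθeq]; exact hθ.2.symm

/-- **`V⁻¹ ∘ J`, the point** (from `VinvStep_Istep_pt` by the swap symmetry). [folklore] -/
theorem VinvStep_Jstep_pt (hch : ∀ z ∈ S, IsZChart S z (Pc z) (Ac z) (nb z))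
    (hsy : ∀ x ∈ S, ∀ y ∈ shell S x, x ∈ shell S y) {x : (EuclideanSpace ℝ (Fin 3))}
    (hx : x ∈ S) {t₁ t₂ : Fin 3 → ℤ} {U : Finset (Fin 3 → ℤ)} (hU : IsFrame (Pc x) t₁ t₂ U)
    (hI : IsFrame (Pc (nb x t₁)) (Istep Pc nb ⟨x, t₁, t₂, U⟩).t₁ (Istep Pc nb ⟨x, t₁, t₂, U⟩).t₂
      (Istep Pc nb ⟨x, t₁, t₂, U⟩).U)
    (hJ : IsFrame (Pc (nb x t₂)) (Jstep Pc nb ⟨x, t₁, t₂, U⟩).t₁ (Jstep Pc nb ⟨x, t₁, t₂, U⟩).t₂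
      (Jstep Pc nb ⟨x, t₁, t₂, U⟩).U)
    (hIi : IsFrame (Pc (nb x (-t₁))) (IinvStep Pc nb ⟨x, t₁, t₂, U⟩).t₁
      (IinvStep Pc nb ⟨x, t₁, t₂, U⟩).t₂ (IinvStep Pc nb ⟨x, t₁, t₂, U⟩).U)
    (hJi : IsFrame (Pc (nb x (-t₂))) (JinvStep Pc nb ⟨x, t₁, t₂, U⟩).t₁
      (JinvStep Pc nb ⟨x, t₁, t₂, U⟩).t₂ (JinvStep Pc nb ⟨x, t₁, t₂, U⟩).U) :
    (VinvStep Pc nb (Jstep Pc nb ⟨x, t₁, t₂, U⟩)).pt =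
        nb (VinvStep Pc nb ⟨x, t₁, t₂, U⟩).pt (VinvStep Pc nb ⟨x, t₁, t₂, U⟩).t₂ ∧
      (VinvStep Pc nb (Jstep Pc nb ⟨x, t₁, t₂, U⟩)).pt ∈ shell S (VinvStep Pc nb ⟨x, t₁, t₂, U⟩).pt ∧
      zlab Pc nb (VinvStep Pc nb ⟨x, t₁, t₂, U⟩).pt (VinvStep Pc nb (Jstep Pc nb ⟨x, t₁, t₂, U⟩)).pt =
        (VinvStep Pc nb ⟨x, t₁, t₂, U⟩).t₂ := by
  have hPx := pattern_cases hch hx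
  obtain ⟨hI', hJ', hIi', hJi'⟩ := swap_hyps (Pc := Pc) (nb := nb) hI hJ hIi hJi
  have hU' : IsFrame (Pc x) t₂ t₁ U := isFrame_swap hU
  obtain ⟨h1, h2, h3⟩ := VinvStep_Istep_pt hch hsy hx hU' hI' hJ' hIi' hJi'
  have hregI' := hregI_of_valid (Pc := Pc) (nb := nb) hI'
  obtain ⟨hyS, -, -, -, -, -, -, -, -, -, -, hframe', -⟩ := Istep_spec hch hsy hx hU' hregI'
  have hPy := pattern_cases hch hyS
  have hVJ : (VinvStep Pc nb (Jstep Pc nb ⟨x, t₁, t₂, U⟩)).pt =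
      (VinvStep Pc nb (Istep Pc nb ⟨x, t₂, t₁, U⟩)).pt := by
    rw [Jstep_swap]
    have h4 := congrArg ZFrame.pt (VinvStep_swap (nb := nb) hPy hframe')
    exact h4
  rw [VinvStep_swap hPx hU] at h1 h2 h3
  rw [hVJ]
  exact ⟨h1, h2, h3⟩

/-! ## Anchor -/

/-- Anchor (registered sub-goal of stmt-AtomisticToContinuum-12088, toward `develop_transport`):
`V⁻¹ ∘ I`, the point (explicit form of `VinvStep_Istep_pt`): for a valid frame whose four
in-layer transports are valid frames, the `V⁻¹`-step of `Ix` lands at the `t₁`-neighbour of the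
frame `V⁻¹ g`, a shell point of its base labelled `(V⁻¹ g).t₁` there. [folklore] -/
theorem transportVComm1_anchor : ∀ (S : Set (EuclideanSpace ℝ (Fin 3))) (Pc : EuclideanSpace ℝ (Fin 3) → Finset (Fin 3 → ℤ)) (Ac : EuclideanSpace ℝ (Fin 3) → (EuclideanSpace ℝ (Fin 3) →ₗᵢ[ℝ] EuclideanSpace ℝ (Fin 3))) (nb : EuclideanSpace ℝ (Fin 3) → (Fin 3 → ℤ) → EuclideanSpace ℝ (Fin 3)), (∀ z ∈ S, IsZChart S z (Pc z) (Ac z) (nb z)) → (∀ x ∈ S, ∀ y ∈ shell S x, x ∈ shell S y) → ∀ x ∈ S, ∀ (t₁ t₂ : Fin 3 → ℤ) (U : Finset (Fin 3 → ℤ)), IsFrame (Pc x) t₁ t₂ U → IsFrame (Pc (nb x t₁)) (Istep Pc nb ⟨x, t₁, t₂, U⟩).t₁ (Istep Pc nb ⟨x, t₁, t₂, U⟩).t₂ (Istep Pc nb ⟨x, t₁, t₂, U⟩).U → IsFrame (Pc (nb x t₂)) (Jstep Pc nb ⟨x, t₁, t₂, U⟩).t₁ (Jstep Pc nb ⟨x,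 t₁, t₂, U⟩).t₂ (Jstep Pc nb ⟨x, t₁, t₂, U⟩).U → IsFrame (Pc (nb x (-t₁))) (IinvStep Pc nb ⟨x, t₁, t₂, U⟩).t₁ (IinvStep Pc nb ⟨x, t₁, t₂, U⟩).t₂ (IinvStep Pc nb ⟨x, t₁, t₂, U⟩).U → IsFrame (Pc (nb x (-t₂))) (JinvStep Pc nb ⟨x, t₁, t₂, U⟩).t₁ (JinvStep Pc nb ⟨x, t₁, t₂, U⟩).t₂ (JinvStep Pc nb ⟨x, t₁, t₂, U⟩).U → (VinvStep Pc nb (Istep Pc nb ⟨x, t₁, t₂, U⟩)).pt = nb (VinvStep Pc nb ⟨x, t₁, t₂, U⟩).pt (VinvStep Pc nb ⟨x, t₁, t₂, U⟩).t₁ ∧ (VinvStep Pc nb (Istep Pc nb ⟨x, t₁, t₂, U⟩)).pt ∈ shell S (VinvStep Pc nb ⟨x, t₁, t₂, U⟩).pt ∧ zlab Pc nb (VinvStep Pc nb ⟨x, t₁, t₂, U⟩).pt (VinvStep Pc nb (Istep Pc nb ⟨x, t₁, t₂, U⟩)).pt = (VinvStep Pc nb ⟨x, t₁, t₂, U⟩).t₁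 :=
  fun _ _ _ _ hch hsy _ hx _ _ _ hU hI hJ hIi hJi => VinvStep_Istep_pt hch hsy hx hU hI hJ hIi hJi

end Summit.AtomisticToContinuum.Crystallization.Theorems.HullExactificationCascadeRobustBarlowTemplate

end
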